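import Literature.MathematicalPhysics.QuantumFieldTheory.Balaban1983to89.Node00.BgCarriersOfRecord
import Literature.MathematicalPhysics.QuantumFieldTheory.Balaban1983to89.B11Eq111FrakG

/-!
# `Balaban1983to89.Node00.BgCarriersOfRecordLit` — THE RECORD READ ON THE LITERATURE'S LATTICE CARRIER: the bridge
# `Site (F.P K) 0 ≃ TSite`, `PBond (F.P K) 0 ≃ Bond` to the periodic-lattice carrier of `B9SectCLatticeCarrier` (compatible with
# the unit steps), the background `U₀` as a units-valued bond field, the space (115) and the size `|·|_{(−3)}` at the record OVER
# THAT CARRIER with lit's covariant gradient `nabla115`, the (19) presentation back on `PBond`, and the PLUG of [B11] (111)'s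
# `𝔊 = frakGAt …` into `BgScheme`'s `𝒢`-slot — OURS (definitional; file 2 of the record-pinned instance road `M1`, no content of Bałaban)

CITATION HEADER (LEAF RULE: pointers BY NAME only).  [Balaban1985Variational] = T. Bałaban, *Commun. Math. Phys.* **102** (1985)
277–309: (115) p. 294, the sizes `|·|_{(−n)}` p. 286, (19) p. 281, (111) p. 294 and (116)–(117) p. 295 (`𝔊 = G₁𝔓*` as the
transformation from `|·|_{(−3)}` to the norm of (115)); [Balaban1985BackgroundPropagators] = *Commun. Math. Phys.* **99** (1985)
389–434: (3.1)–(3.3) p. 390–391; [Balaban1987RG1] (0.1) p. 251 (the periodic lattice).  Tree inputs, by name: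
`B4Sect5Torus.TSite`, `B9SectCLatticeCarrier.{shift, Bond, bpos, btgt}` (lit's unit periodic lattice and its bonds),
`B9Eq33CovDerivVector.{adTransport, adTransport_apply, covGrad}`, `B11Eq111FrakG.{nabla115, frakGAt}` (INTERFACE REQUEST NE9 (L2)),
`B11Eq115Space.{Space115, NegSize, JetSup.equiv, levOf}`, `Setup.{Site, Site.shift, PBond, PBond.tgt, GaugeField, Params.eta,
Params.sitesPerDir}`, `Node00.DatumAvLayer.SU`, `Node00.BackgroundMapOfRecord.BgScheme`, `Node00.BgCarriersOfRecord.{adTransportOfRecord,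
factL, factEta}`; Mathlib's `ZMod.finEquiv`, `Function.update`, `Units`, and the `L²`-operator norm on `Matrix (Fin N) (Fin N) ℂ`
opened by `open scoped Matrix.Norms.L2Operator` as in `Node00.CarriersB12Chart` (no instance is declared in this file).

WHAT THIS MODULE DOES (pub-ymgap bus INTENT-4; census I.22727).  Every letter the record instance of [B11] Prop. 6's data must
consume is typed lit-side on the carrier `Bond d Pd = TSite d Pd × Fin d` (`TSite d Pd = Π_i Fin (Pd i)`): `B11Eq111FrakG.frakGAt`
(the object `𝔊` at a background), `B11Eq117ReadLettersBridge` (its (117) operator-norm bound from sup → sup letters),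
`B11Eq117LetterDefects` (the two-norm comparison `∇_U` vs `∇_1`).  Node00's record lives on `PBond (F.P K) 0` over
`Site (F.P K) 0 = Fin d → ZMod (sitesPerDir 0)`.  This file reads the record on lit's carrier, so that those letters apply by
substitution and only the presentation `ev` and the background cross the bridge:
* §1 `siteToLit P j : Site P j ≃ TSite P.d (fun _ => P.sitesPerDir j)` (`ZMod.finEquiv` coordinatewise) with
  `siteToLit_shift : siteToLit (x.shift μ) = shift μ (siteToLit x)`; `bondToLit P j : PBond P j ≃ Bond P.d (fun _ => P.sitesPerDir j)`
  with `bpos_bondToLit`, `btgt_bondToLit` (lit's bond ends ARE the record's `b.src`, `b.tgt`);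
* §2 `suToUnits : SU N → (M_N(ℂ))ˣ` (values in `B12RegularSpaces111SpecialUnitary.suUnits N`, not imported) and the background as lit's transporter datum `unitsOfRecord U₀ : Bond … → (M_N(ℂ))ˣ`, with
  `adTransport_unitsOfRecord`: lit's `R(U)` ((3.1), `B9Eq33CovDerivVector.adTransport`) at `bondToLit b` IS Node00's
  `adTransportOfRecord U₀ b` (`Node00.BgCarriersOfRecord`);
* §3 the level maps read on lit's carrier (`siteLevLit`, `bondLevLit`, `pairLevLit`) and the carriers
  `Space115Lit F N K k Ω U₀ := Space115 (F.L) ((F.P K).eta k) (bondLevLit …) (pairLevLit …) (nabla115 ((F.P K).eta k) (unitsOfRecord U₀))`,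
  `NegSizeLit F N K k Ω n`; instances FOUND given `factL`, `factEta` (`instBundle115Lit`, `instBundleNegLit`);
* §4 `evLit` = the (19) presentation back on the record's bonds: `A ↦ (b ↦ A (bondToLit b))`, ℂ-linear, injective;
* §5 `BgSchemeOnLit F N K k Ω U₀ := BgScheme F N (Space115Lit … U₀) (NegSizeLit … 3) K k` and THE PLUG `frakGOfLetters`: for ANY
  letters `G₁ Q Qadj Kinv D R Dstar` on `Bond … → M_N(ℂ)` (NE9's rectangular letters, DATA here), lit's
  `frakGAt (pairLevLit …) (unitsOfRecord U₀) G₁ Q Qadj Kinv D R Dstar` HAS the type `NegSizeLit … 3 →L[ℂ] Space115Lit … U₀` of the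
  scheme's `𝒢`-slot — no adapter.
HONEST LABELS.  (1) DEFINITIONAL/BOOKKEEPING: nothing of Bałaban is proved.  (2) FORMAT, NOT CONTENT: `frakGOfLetters` takes the letters
as free data; the record's letters (`G₁ = G1 (Δ(U₀)) …` read on `M_N(ℂ)`-valued functions, `Q` from the averaging of record, the axial
`D, R`) are lit-balaban's INTERFACE REQUEST NE9 and are NOT here.  (3) INDEX CONVENTION: lit's `covGrad` pairs `((x, μ), ν) ↦ D_μ A_ν(x)`
(transport along the bond, component `ν`), Node00's native `nablaOfRecord` pairs `((x, μ), ν) ↦ D_ν A_μ(x)`; both families carry the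
level of `x`, so the two (115) norms take the supremum of the same weighted set — the comparison lemma is deferred (not needed by the
lit-side road).  (4) CARRIER FORK F1 kept: one carrier per background `U₀`.  (5) FIBRE `M_N(ℂ)` with the `L²`-operator norm (print's `|X|`).
-/

open scoped Matrix.Norms.L2Operator

namespace Literature.MathematicalPhysics.QuantumFieldTheory.Balaban1983to89.Node00

open T4Continuum (T4Family)
open B4Sect5Torus (TSite)
open B9SectCLatticeCarrier (shift Bond bpos btgt)
open B9Eq33CovDerivVector (adTransport adTransport_apply)
open B11Eq111FrakG (nabla115 frakGAt)
open B11Eq115Space (Space115 NegSize JetSup levOf levOf_le)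

noncomputable section

/-! ## §1. The lattice bridge `Site ≃ TSite`, `PBond ≃ Bond` ([Balaban1987RG1] (0.1): the periodic lattice) -/

section Bridge

variable (P : Params) (j : ℕ)

/-- **The record's sites read on lit's periodic-lattice carrier**: `ZMod (sitesPerDir j) ≃ Fin (sitesPerDir j)` coordinatewise
(`ZMod.finEquiv`). [cite: Balaban1987RG1, (0.1) p.251] -/
def siteToLit : Site P j ≃ TSite P.d (fun _ => P.sitesPerDir j) where
  toFun x i := (ZMod.finEquiv (P.sitesPerDir j)).symm (x i)
  invFun y i := ZMod.finEquiv (P.sitesPerDir j) (y i)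
  left_inv _ := funext fun _ => RingEquiv.apply_symm_apply _ _
  right_inv _ := funext fun _ => RingEquiv.symm_apply_apply _ _

variable {P j} in
/-- Unfolding a coordinate. [cite: Balaban1987RG1, (0.1) p.251] -/
theorem siteToLit_apply (x : Site P j) (i : Fin P.d) : siteToLit P j x i = (ZMod.finEquiv (P.sitesPerDir j)).symm (x i) := rfl

variable {P j} in
/-- **The bridge commutes with the unit steps**: `x + e_μ` of the record (`Site.shift`, in `ZMod`) is lit's `shift μ` (in `Fin`, mod `P_μ`).
[cite: Balaban1987RG1, (0.1) p.251] -/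
theorem siteToLit_shift (x : Site P j) (μ : Fin P.d) : siteToLit P j (x.shift μ) = shift μ (siteToLit P j x) := by
  funext i
  simp only [siteToLit_apply, Site.shift, B9SectCLatticeCarrier.shift]
  by_cases h : i = μ
  · subst h
    rw [Function.update_self, Function.update_self]
    apply Fin.ext
    rw [map_add, map_one, Fin.val_add, Fin.val_one', Nat.add_mod_mod]
  · rw [Function.update_of_ne h, Function.update_of_ne h]
    rfl

/-- **The record's bonds read on lit's carrier**: `⟨x, μ⟩ ↦ (x, μ)`. [cite: Balaban1987RG1, (0.1) p.251] -/
def bondToLit : PBond P j ≃ Bond P.d (fun _ => P.sitesPerDir j) where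
  toFun b := (siteToLit P j b.src, b.dir)
  invFun a := ⟨(siteToLit P j).symm a.1, a.2⟩
  left_inv b := by
    rcases b with ⟨s, μ⟩
    simp only [Equiv.symm_apply_apply]
  right_inv a := Prod.ext (Equiv.apply_symm_apply _ _) rfl

variable {P j} in
/-- The base of the lit bond is the record bond's initial point. [cite: Balaban1985BackgroundPropagators, (3.3) p.391] -/
theorem bpos_bondToLit (b : PBond P j) : bpos (bondToLit P j b) = siteToLit P j b.src := rfl

variable {P j} in
/-- The direction is unchanged. [cite: Balaban1985BackgroundPropagators, (3.3) p.391] -/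
theorem bondToLit_snd (b : PBond P j) : (bondToLit P j b).2 = b.dir := rfl

variable {P j} in
/-- **The target of the lit bond is the record bond's final point `b₊`** (`PBond.tgt`). [cite: Balaban1985BackgroundPropagators, (3.3) p.391] -/
theorem btgt_bondToLit (b : PBond P j) : btgt (bondToLit P j b) = siteToLit P j b.tgt :=
  (siteToLit_shift b.src b.dir).symm

variable {P j} in
/-- Unfolding the inverse bridge. [cite: Balaban1987RG1, (0.1) p.251] -/
theorem bondToLit_symm_apply (a : Bond P.d (fun _ => P.sitesPerDir j)) :
    (bondToLit P j).symm a = ⟨(siteToLit P j).symm a.1, a.2⟩ := rfl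

end Bridge

variable (F : T4Family) (N : ℕ)

/-! ## §2. The background as lit's transporter datum ((3.1) p. 390) -/

/-- An `SU(N)` matrix as a unit of `M_N(ℂ)` (inverse = the group inverse). [cite: Balaban1985BackgroundPropagators, (3.1) p.390] -/
def suToUnits (U : SU N) : (Matrix (Fin N) (Fin N) ℂ)ˣ where
  val := (U : Matrix (Fin N) (Fin N) ℂ)
  inv := ((U⁻¹ : SU N) : Matrix (Fin N) (Fin N) ℂ)
  val_inv := by
    have h : ((U * U⁻¹ : SU N) : Matrix (Fin N) (Fin N) ℂ) = 1 := by rw [mul_inv_cancel]; rfl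
    rwa [Submonoid.coe_mul] at h
  inv_val := by
    have h : ((U⁻¹ * U : SU N) : Matrix (Fin N) (Fin N) ℂ) = 1 := by rw [inv_mul_cancel]; rfl
    rwa [Submonoid.coe_mul] at h

variable {N} in
/-- Unfolding. [cite: Balaban1985BackgroundPropagators, (3.1) p.390] -/
theorem coe_suToUnits (U : SU N) : (suToUnits N U : Matrix (Fin N) (Fin N) ℂ) = (U : Matrix (Fin N) (Fin N) ℂ) := rfl

variable {N} in
/-- Unfolding the inverse. [cite: Balaban1985BackgroundPropagators, (3.1) p.390] -/
theorem coe_suToUnits_inv (U : SU N) :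
    ((suToUnits N U)⁻¹ : (Matrix (Fin N) (Fin N) ℂ)ˣ) = (((U⁻¹ : SU N) : Matrix (Fin N) (Fin N) ℂ) : Matrix (Fin N) (Fin N) ℂ) := rfl

/-- **The background `U₀` as a units-valued field on lit's bonds** (the transporter datum of `adTransport`/`covGrad`/`nabla115`).
[cite: Balaban1985BackgroundPropagators, (3.1) p.390] -/
def unitsOfRecord {K : ℕ} (U₀ : GaugeField (F.P K) 0 (SU N)) :
    Bond (F.P K).d (fun _ => (F.P K).sitesPerDir 0) → (Matrix (Fin N) (Fin N) ℂ)ˣ :=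
  fun a => suToUnits N (U₀ ((bondToLit (F.P K) 0).symm a))

variable {F N} in
/-- Unfolding at a record bond. [cite: Balaban1985BackgroundPropagators, (3.1) p.390] -/
theorem unitsOfRecord_bondToLit {K : ℕ} (U₀ : GaugeField (F.P K) 0 (SU N)) (b : PBond (F.P K) 0) :
    unitsOfRecord F N U₀ (bondToLit (F.P K) 0 b) = suToUnits N (U₀ b) := by
  simp only [unitsOfRecord, Equiv.symm_apply_apply]

variable {F N} in
/-- **Lit's `R(U)` at the record's background IS Node00's `adTransportOfRecord`** (both are `X ↦ U₀(b) X U₀(b)⁻¹`).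
[cite: Balaban1985BackgroundPropagators, (3.1) p.390] -/
theorem adTransport_unitsOfRecord {K : ℕ} (U₀ : GaugeField (F.P K) 0 (SU N)) (b : PBond (F.P K) 0) (X : Matrix (Fin N) (Fin N) ℂ) :
    adTransport (𝕜 := ℂ) (unitsOfRecord F N U₀) (bondToLit (F.P K) 0 b) X = adTransportOfRecord F N U₀ b X := by
  rw [adTransport_apply, adTransportOfRecord_apply, unitsOfRecord_bondToLit, coe_suToUnits_inv, coe_suToUnits]

/-! ## §3. Levels and the carriers `𝒴 = (115)`, `𝒵 = |·|_{(−n)}` on lit's carrier ([B11] (115) p. 294, p. 286) -/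

/-- The level `j(y)` of a lit site: that of the record site it comes from, for a domain sequence `Ω` of the fine lattice.
[cite: Balaban1985Variational, p.286] -/
def siteLevLit {K : ℕ} (Ω : ℕ → Set (Site (F.P K) 0)) (k : ℕ) : TSite (F.P K).d (fun _ => (F.P K).sitesPerDir 0) → ℕ :=
  fun y => levOf Ω k ((siteToLit (F.P K) 0).symm y)

/-- The level of a lit bond: that of its base. [cite: Balaban1985Variational, p.286] -/
def bondLevLit {K : ℕ} (Ω : ℕ → Set (Site (F.P K) 0)) (k : ℕ) : Bond (F.P K).d (fun _ => (F.P K).sitesPerDir 0) → ℕ :=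
  fun a => siteLevLit F Ω k (bpos a)

/-- The level of a pair `(a, ν)` (a point of `∇A`): that of the bond's base. [cite: Balaban1985Variational, p.286, (115) p.294] -/
def pairLevLit {K : ℕ} (Ω : ℕ → Set (Site (F.P K) 0)) (k : ℕ) : Bond (F.P K).d (fun _ => (F.P K).sitesPerDir 0) × Fin (F.P K).d → ℕ :=
  fun p => siteLevLit F Ω k (bpos p.1)

variable {F} in
/-- At a record bond the lit level is the record level `j(b.src)` (`Node00.bondLev`). [cite: Balaban1985Variational, p.286] -/
theorem bondLevLit_bondToLit {K : ℕ} (Ω : ℕ → Set (Site (F.P K) 0)) (k : ℕ) (b : PBond (F.P K) 0) :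
    bondLevLit F Ω k (bondToLit (F.P K) 0 b) = bondLev F Ω k b := by
  simp only [bondLevLit, siteLevLit, bpos_bondToLit, Equiv.symm_apply_apply, bondLev_apply]

variable {F} in
/-- Levels are at most `k`. [cite: Balaban1985Variational, p.286] -/
theorem bondLevLit_le {K : ℕ} (Ω : ℕ → Set (Site (F.P K) 0)) (k : ℕ) (a : Bond (F.P K).d (fun _ => (F.P K).sitesPerDir 0)) :
    bondLevLit F Ω k a ≤ k := levOf_le Ω k _

variable {F} in
/-- Levels are at most `k`. [cite: Balaban1985Variational, p.286] -/
theorem pairLevLit_le {K : ℕ} (Ω : ℕ → Set (Site (F.P K) 0)) (k : ℕ) (p : Bond (F.P K).d (fun _ => (F.P K).sitesPerDir 0) × Fin (F.P K).d) :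
    pairLevLit F Ω k p ≤ k := levOf_le Ω k _

/-- **The space (115) at the record, read on lit's carrier**: `M_N(ℂ)`-valued functions on lit's bonds with the norm
`max{|A′|_{(−1)}, |∇^{U₀}A′|_{(−2)}}`, `∇^{U₀} := nabla115 η (unitsOfRecord U₀)` (lit's (3.3)), `η = L^{-k}`, levels from `Ω`.
[cite: Balaban1985Variational, (115) p.294] -/
abbrev Space115Lit (K k : ℕ) (Ω : ℕ → Set (Site (F.P K) 0)) (U₀ : GaugeField (F.P K) 0 (SU N)) : Type :=
  Space115 (𝕜 := ℂ) (V := Matrix (Fin N) (Fin N) ℂ) (F.L : ℝ) ((F.P K).eta k) (bondLevLit F Ω k) (pairLevLit F Ω k)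
    (nabla115 ((F.P K).eta k) (unitsOfRecord F N U₀))

/-- **The size `|·|_{(−n)}` at the record, read on lit's carrier** (`n = 3`: the currents, the target of `𝔊`). [cite: Balaban1985Variational, p.286, (117) p.295] -/
abbrev NegSizeLit (K k : ℕ) (Ω : ℕ → Set (Site (F.P K) 0)) (n : ℕ) : Type :=
  NegSize (F.L : ℝ) ((F.P K).eta k) (bondLevLit F Ω k) n (Matrix (Fin N) (Fin N) ℂ)

variable {F N} in
/-- The instance bundle of (115) on lit's carrier is FOUND, given the two positivity facts (`Node00.factL`, `Node00.factEta`).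
[cite: Balaban1985Variational, (115) p.294] -/
theorem instBundle115Lit (K k : ℕ) (Ω : ℕ → Set (Site (F.P K) 0)) (U₀ : GaugeField (F.P K) 0 (SU N))
    [Fact (0 < (F.L : ℝ))] [Fact (0 < (F.P K).eta k)] :
    Nonempty (NormedAddCommGroup (Space115Lit F N K k Ω U₀)) ∧ Nonempty (NormedSpace ℂ (Space115Lit F N K k Ω U₀))
      ∧ CompleteSpace (Space115Lit F N K k Ω U₀) :=
  ⟨⟨inferInstance⟩, ⟨inferInstance⟩, inferInstance⟩

variable {F N} in
/-- The instance bundle of `|·|_{(−n)}` on lit's carrier is FOUND, given the two positivity facts. [cite: Balaban1985Variational, p.286] -/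
theorem instBundleNegLit (K k : ℕ) (Ω : ℕ → Set (Site (F.P K) 0)) (n : ℕ) [Fact (0 < (F.L : ℝ))] [Fact (0 < (F.P K).eta k)] :
    Nonempty (NormedAddCommGroup (NegSizeLit F N K k Ω n)) ∧ Nonempty (NormedSpace ℂ (NegSizeLit F N K k Ω n))
      ∧ CompleteSpace (NegSizeLit F N K k Ω n) :=
  ⟨⟨inferInstance⟩, ⟨inferInstance⟩, inferInstance⟩

/-! ## §4. The (19) presentation back on the record's bonds -/

/-- **The presentation map** for `BgScheme.ev` on the lit-side carrier: a jet `A′` is read as the record bond function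
`b ↦ A′(bondToLit b) ∈ M_N(ℂ)` (the `A′` of `U′ = exp(iηA′)U₀`, (19) p. 281); ℂ-linear. [cite: Balaban1985Variational, (19) p.281, (115) p.294] -/
def evLit (K k : ℕ) (Ω : ℕ → Set (Site (F.P K) 0)) (U₀ : GaugeField (F.P K) 0 (SU N)) :
    Space115Lit F N K k Ω U₀ →ₗ[ℂ] (PBond (F.P K) 0 → Matrix (Fin N) (Fin N) ℂ) where
  toFun A b := JetSup.equiv _ _ _ A (bondToLit (F.P K) 0 b)
  map_add' _ _ := rfl
  map_smul' _ _ := rfl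

variable {F N} in
/-- Unfolding: `ev A b = A (bondToLit b)`. [cite: Balaban1985Variational, (19) p.281] -/
theorem evLit_apply (K k : ℕ) (Ω : ℕ → Set (Site (F.P K) 0)) (U₀ : GaugeField (F.P K) 0 (SU N)) (A : Space115Lit F N K k Ω U₀)
    (b : PBond (F.P K) 0) : evLit F N K k Ω U₀ A b = JetSup.equiv _ _ _ A (bondToLit (F.P K) 0 b) := rfl

variable {F N} in
/-- The presentation is injective (the bridge is a bijection of bonds). [cite: Balaban1985Variational, (19) p.281] -/
theorem evLit_injective (K k : ℕ) (Ω : ℕ → Set (Site (F.P K) 0)) (U₀ : GaugeField (F.P K) 0 (SU N)) :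
    Function.Injective (evLit F N K k Ω U₀) := by
  intro A B h
  apply (JetSup.equiv _ _ _).injective
  funext a
  have := congrFun h ((bondToLit (F.P K) 0).symm a)
  simpa only [evLit_apply, Equiv.apply_symm_apply] using this

/-! ## §5. `BgScheme`s on the lit-side carrier and the plug of (111)'s `𝔊` -/

/-- **`BgScheme`s over the lit-side record carriers at background `U₀`** (`Node00.BackgroundMapOfRecord.BgScheme` with
`𝒴 := Space115Lit … U₀`, `𝒵 := NegSizeLit … 3`; one carrier per background). [cite: Balaban1985Variational, (117) p.295] -/
abbrev BgSchemeOnLit (K k : ℕ) (Ω : ℕ → Set (Site (F.P K) 0)) (U₀ : GaugeField (F.P K) 0 (SU N))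
    [Fact (0 < (F.L : ℝ))] [Fact (0 < (F.P K).eta k)] : Type :=
  BgScheme F N (Space115Lit F N K k Ω U₀) (NegSizeLit F N K k Ω 3) K k

variable {F N} in
/-- **THE PLUG: [B11] (111)'s `𝔊 = G₁𝔓*` at the record's background, for given Sect. D letters, IS a `𝒢`-slot value of
`BgSchemeOnLit`** — lit's `frakGAt (pairLevLit …) (unitsOfRecord U₀) G₁ Q Qadj Kinv D R Dstar : NegSizeLit … 3 →L[ℂ] Space115Lit … U₀`
(FORMAT: the letters `G₁, Q, Q*, (QG₁Q*)⁻¹, D, R, D*` are DATA here; the record's letters are INTERFACE REQUEST NE9).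
[cite: Balaban1985Variational, (111) p.294, (116)–(117) p.295] -/
def frakGOfLetters (K k : ℕ) (Ω : ℕ → Set (Site (F.P K) 0)) (U₀ : GaugeField (F.P K) 0 (SU N))
    [Fact (0 < (F.L : ℝ))] [Fact (0 < (F.P K).eta k)] {𝔽 𝕊 : Type*} [AddCommGroup 𝔽] [Module ℂ 𝔽] [AddCommGroup 𝕊] [Module ℂ 𝕊]
    (G₁ : (Bond (F.P K).d (fun _ => (F.P K).sitesPerDir 0) → Matrix (Fin N) (Fin N) ℂ) →ₗ[ℂ]
      (Bond (F.P K).d (fun _ => (F.P K).sitesPerDir 0) → Matrix (Fin N) (Fin N) ℂ))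
    (Q : (Bond (F.P K).d (fun _ => (F.P K).sitesPerDir 0) → Matrix (Fin N) (Fin N) ℂ) →ₗ[ℂ] 𝔽)
    (Qadj : 𝔽 →ₗ[ℂ] (Bond (F.P K).d (fun _ => (F.P K).sitesPerDir 0) → Matrix (Fin N) (Fin N) ℂ)) (Kinv : 𝔽 →ₗ[ℂ] 𝔽)
    (D : 𝕊 →ₗ[ℂ] (Bond (F.P K).d (fun _ => (F.P K).sitesPerDir 0) → Matrix (Fin N) (Fin N) ℂ)) (R : 𝕊 →ₗ[ℂ] 𝕊)
    (Dstar : (Bond (F.P K).d (fun _ => (F.P K).sitesPerDir 0) → Matrix (Fin N) (Fin N) ℂ) →ₗ[ℂ] 𝕊) :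
    NegSizeLit F N K k Ω 3 →L[ℂ] Space115Lit F N K k Ω U₀ :=
  frakGAt (pairLevLit F Ω k) (unitsOfRecord F N U₀) G₁ Q Qadj Kinv D R Dstar

end

end Literature.MathematicalPhysics.QuantumFieldTheory.Balaban1983to89.Node00
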